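/-
Copyright (c) 2026 the pub-hodgecm-mathlib formalisation cell (harness21).  Prover seat hodgecm-mathlib-K2E3-p05 (g3), Track B «K2-LIT», engine E3, unit U4 «Keys»; U4-f
`χ₂`-ELIMINATION (the open leaf of U4 stated `χ₂`-free) and the bookkeeping `hU ⟹ χ₁ unramified`; 2026-09-04.  KERNEL module: THEOREMS ONLY (no definition, no named fact, no
`sorry`, no instance, no notation).
-/
import Summits.HodgeConjecture.HodgeConjecture.Theorems.K2E3KeysThmTwoContractingUnramifiedChar   -- ★ p857431 (K2E3-p06 (g4)): `keysThmTwoContracting_of_unramifiedChar` (U4-f for unramified `χ₁`, any `χ₂`); brings ★ p857080, ★ p857330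
import Summits.HodgeConjecture.HodgeConjecture.Theorems.F0P3cStCharTSTorusChartIso               -- ★ `torusChart_mem_cmLocalIntegralLevel_iff` (`ι(α, z) ∈ K_v ⟺ α ∈ 𝒪_vˣ`)
import HarnessLib

/-!
# h413 ∕ Track B «K2-LIT», unit U4 «Keys»: U4-f `sig_K2E3KeysThmTwoContracting` — `χ₂`-ELIMINATION «U4-f at `(L, v)` ⟸ its instance `χ₂ = 1`, `χ₁` RAMIFIED», and `hU ⟹ χ₁ unramified`
# [Keys1984 §7 Thm (2); Rogawski1990 §12.1–§12.2; BernsteinZelevinsky1977 1.9]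

Cell `pub/hodgecm-mathlib`, crux H413 = `stmt-HodgeConjecture-24833` (lane `--supports … --as helper`), route HCCMUnconditional; dealer K2E3-plan (g3); line file
`Cruxes/H413/Lines/K2_E3_EllipticInputsSigs_U4Keys.lean` ED. 5 (U4-f re-cut `by_cases hU`: leaf (U4f-unr-χ) «`χ = (χ₁, χ₂)` trivial on `T ∩ K_v`» ★ p857330, leaf (U4f-ram-χ) «`¬ hU`»
OPEN); K2E3-p06 (g4)'s census (D59) `K2/K2E3-p06/g4/CENSUS-U4f-PosLevel.K2E3-p06-g4.md` §0∕(E1)–(E2) and ★ p857431 `K2E3KeysThmTwoContractingUnramifiedChar` (U4-f for every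
UNRAMIFIED `χ₁` and EVERY `χ₂`, by the det-twist ★ p857080 ∘ ★ `cmTorusCharPair_one_eq_one_of_unramified` ∘ ★ p857330).

THIS FILE states the ONE remaining open leaf of U4 `χ₂`-FREE and ties U4-f to it:

* §1 **`chiOneUnramified_of_levelTrivial`** — `hU` («`(χ₁, χ₂)` trivial on `T ∩ K_v`») ⟹ `χ₁ = 1` on `𝒪_vˣ = (Π_{w∣v} 𝒪_w)ˣ` (with ★ `K2E3KeysThmTwoIwahoriQuartet.eq_one_of_levelTrivial`:
  `hU ⟺ (χ₁ unramified ∧ χ₂ = 1)`; so ED. 5's ★ leaf (U4f-unr-χ) ⊂ ★ p857431's «`χ₁` unramified»), via the torus chart `ι(α, 1)` (★ `torusChart_mem_cmLocalIntegralLevel_iff`,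
  ★ `cmTorusCharPair_torusChart`).
* §2 **`keysThmTwoContracting_of_ramifiedCharOne`** — `χ₂`-ELIMINATION: at a non-split `v`, U4-f for EVERY pair `(χ₁, χ₂)` follows from the `χ₂`-FREE statement
  «`H` : for every continuous, non-unitary, contracting `χ₁` with `¬ (χ₁ = 1 on 𝒪_vˣ)`, a reducible `i_G(χ₁, 1)` forces the Keys list for `χ₁`» (`by_cases` on the conductor of `χ₁`:
  unramified ↦ ★ p857431; ramified ↦ `H` fed with ★ p857080 `reducible_iff_reducible_one`).  `H` is the recommended text of the open leaf — (U4f-χ₁-ram-one)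
  `sig_K2E3KeysThmTwoContractingRamifiedCharOne` — one coordinate smaller than (E2)'s (U4f-χ₁-ram) (which keeps `χ₂`); **`keysThmTwoContracting_of_ramifiedChar`** is the same tie
  over (E2)'s two-coordinate leaf, for a dealer who prefers U4-f's own binder shape.
* §3 **`keysThmTwoContractingPosLevel_of_ramifiedCharOne`** — ED. 5's open leaf (U4f-ram-χ) `sig_K2E3KeysThmTwoContractingPosLevel` (its `¬ hU` kept, idle) ⟸ the same `χ₂`-free `H`
  (the append-only re-tie of ED. 5: PosLevel REL over {(U4f-χ₁-ram-one)}).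

What it does NOT cover: the leaf `H` itself — `χ₁` RAMIFIED (conductor ≥ 1), `χ₂ = 1`: `i_G(χ₁, 1)` has no Iwahori-fixed vector (Road II's plane is zero) and no `K_v`-fixed vector
(Road I's spherical line is empty); Keys §4–§6 (the rank-one intertwining operator at positive conductor, its γ-factor) — census (D59) (M1)–(M4), XL.

HONEST LABEL.  HC_CM is proved only modulo the 7 printed citations (2 remaining named inputs: hLiu418 = `stmt-HodgeConjecture-24832`, h413 = `stmt-HodgeConjecture-24833`) until
rung 0 closes; count-neutral (U4 helper: the open leaf of U4-f is «conductor of `χ₁` ≥ 1, `χ₂ = 1`»).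

## References
* [Keys1984] D. Keys, *Principal series representations of special unitary groups over local fields*, Compositio Math. 51 (1984), §7 Theorem (2) p. 126 (the list depends on
  `λ = χ|_{SU}` only).
* [Rogawski1990] J. D. Rogawski, *Automorphic Representations of Unitary Groups in Three Variables*, Ann. of Math. Stud. 123 (1990), §12.1 p. 171 (`χ = (χ₁, χ₂)`,
  `χ(d(α, β, ᾱ⁻¹)) = χ₁(α)χ₂(αᾱ⁻¹β)`), §12.2 (1)–(2) p. 173 (the reducibility points; `K = U(Φ₃)(𝒪)`).
* [BernsteinZelevinsky1977] I. N. Bernstein, A. V. Zelevinsky, *Induced representations of reductive `p`-adic groups I*, Ann. Sci. ÉNS 10 (1977), 1.9 (`χ ⊗ Ind σ ≅ Ind (χ|_H ⊗ σ)`).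
-/

set_option autoImplicit false
-- the mandated namespace repeats the single-problem summit's segment (`HodgeConjecture.HodgeConjecture`)
set_option linter.dupNamespace false

noncomputable section

open NumberField IsDedekindDomain
open scoped Matrix NNReal
open Literature.NumberTheory Literature.NumberTheory.Automorphic Literature.NumberTheory.Automorphic.UnitaryGroup
open Literature.NumberTheory.Rogawski1990 Literature.NumberTheory.GaloisRepresentations

namespace Summit.HodgeConjecture.HodgeConjecture.Cruxes.H413.K2E3KeysThmTwoChiTwoElimination

open Summit.HodgeConjecture.HodgeConjecture.Cruxes.H413

variable (L : Type) [Field L] [NumberField L] [IsCMField L] (v : HeightOneSpectrum (𝓞 ↥(maximalRealSubfield L)))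

/-! ## §1 `hU ⟹ χ₁ unramified`: ED. 5's level hypothesis pins the conductor of `χ₁` -/

/-- **`(χ₁, χ₂)` TRIVIAL ON `T ∩ K_v` ⟹ `χ₁ = 1` ON `𝒪_vˣ = (Π_{w∣v} 𝒪_w)ˣ`** (`v` non-split).  First `χ₂ = 1` (★ `K2E3KeysThmTwoIwahoriQuartet.eq_one_of_levelTrivial`); then for `α ∈ 𝒪_vˣ`
the torus element `ι(α, 1) = d(α, 1·…, ᾱ⁻¹)` lies in `K_v` (★ `torusChart_mem_cmLocalIntegralLevel_iff`) and `χ(ι(α, 1)) = χ₁(α) · 1` (★ `cmTorusCharPair_torusChart`).  With the converse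
★ `K2E3KeysThmTwoUnramifiedLineReduction.cmTorusCharPair_one_eq_one_of_unramified`: `hU ⟺ (χ₁ unramified ∧ χ₂ = 1)` — ED. 5's ★ leaf (U4f-unr-χ) is the `χ₂ = 1` slice of ★ p857431.
[cite: Rogawski1990, §12.1 p. 171; §12.2 p. 173] -/
theorem chiOneUnramified_of_levelTrivial (hns : ∀ w : PlacesOver L v, IsCMField.complexConj L • w.1 = w.1)
    (χ₁ : (UnitaryGroup.LocalRing L v)ˣ →* ℂˣ) (χ₂ : ↥(normOneUnits (conjLocal L (IsCMField.complexConj L) v)) →* ℂˣ)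
    (hU : ∀ t : ↥(torusU (conjLocal L (IsCMField.complexConj L) v) (cmLocalForm L 3 v)),
      (t : ↥(unitaryGroupOfForm (conjLocal L (IsCMField.complexConj L) v) (cmLocalForm L 3 v))) ∈ cmLocalIntegralLevel L 3 (qsForm L) v →
        UnitaryGroup.cmTorusCharPair L v χ₁ χ₂ t = 1) :
    ∀ u ∈ (Submonoid.pi Set.univ (fun w : PlacesOver L v => (w.1.adicCompletionIntegers L).toSubring.toSubmonoid)).units, χ₁ u = 1 := by
  have h2 : χ₂ = 1 := K2E3KeysThmTwoIwahoriQuartet.eq_one_of_levelTrivial L v hns χ₁ χ₂ hU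
  subst h2
  intro u hu
  have ht := hU (F0P3cStCharTSTorusDefs.torusChart L v (u, 1))
    ((F0P3cStCharTSTorusChartIso.torusChart_mem_cmLocalIntegralLevel_iff L v hns _).2 (Subgroup.mem_prod.2 ⟨hu, Subgroup.mem_top _⟩))
  rw [F0P3cStCharTSTorusDefs.cmTorusCharPair_torusChart, MonoidHom.one_apply, mul_one] at ht
  exact ht

/-! ## §2 `χ₂`-ELIMINATION: U4-f at `(L, v)` follows from its instance «`χ₁` RAMIFIED, `χ₂ = 1`» -/

/-- **U4-f ⟸ ITS `χ₂ = 1` INSTANCE FOR RAMIFIED `χ₁` (the open leaf of U4, `χ₂`-free).**  At a non-split `v`: IF for every continuous, non-unitary, contracting `χ₁` which is NOT trivial on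
`(Π_{w∣v} 𝒪_w)ˣ` a reducible `i_G(χ₁, 1)` forces the Keys list for `χ₁` (hypothesis `H` = the text of (U4f-χ₁-ram-one)), THEN U4-f holds at `(L, v)` for EVERY pair `(χ₁, χ₂)` (`χ₂` continuous):
`by_cases` on «`χ₁ = 1` on `𝒪_vˣ`» — the unramified branch is ★ p857431 `keysThmTwoContracting_of_unramifiedChar`, the ramified branch is `H` fed with ★ p857080 (`i_G(χ₁, χ₂)` reducible ⟹
`i_G(χ₁, 1)` reducible, the twist by `χ₂⁻¹∘det_G`). [cite: Keys1984, §7 Theorem (2) p. 126] [cite: Rogawski1990, §12.2 (1)–(2) p. 173] [cite: BernsteinZelevinsky1977, 1.9] -/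
theorem keysThmTwoContracting_of_ramifiedCharOne
    (hns : ∀ w : PlacesOver L v, IsCMField.complexConj L • w.1 = w.1)
    (H : ∀ χ₁ : (UnitaryGroup.LocalRing L v)ˣ →* ℂˣ, Continuous (fun x => ((χ₁ x : ℂˣ) : ℂ)) → (∃ x, ‖((χ₁ x : ℂˣ) : ℂ)‖ ≠ 1) →
      (∀ x : (UnitaryGroup.LocalRing L v)ˣ, unitModulusChar (UnitaryGroup.LocalRing L v) x < 1 → ‖((χ₁ x : ℂˣ) : ℂ)‖ < 1) →
      ¬ (∀ u ∈ (Submonoid.pi Set.univ (fun w : PlacesOver L v => (w.1.adicCompletionIntegers L).toSubring.toSubmonoid)).units, χ₁ u = 1) →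
      (∃ N : Subrepresentation (UnitaryGroup.cmPrincipalSeries L 3 v (UnitaryGroup.cmTorusCharPair L v χ₁ 1)), N ≠ ⊥ ∧ N ≠ ⊤) →
      χ₁ = halfModulusChar (UnitaryGroup.LocalRing L v) * halfModulusChar (UnitaryGroup.LocalRing L v) ∨
        (∃ η : (UnitaryGroup.LocalRing L v)ˣ →* ℂˣ, IsQuadraticCharExtension (conjLocal L (IsCMField.complexConj L) v) η ∧
          Continuous (fun x => ((η x : ℂˣ) : ℂ)) ∧ χ₁ = η * halfModulusChar (UnitaryGroup.LocalRing L v)))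
    (χ₁ : (UnitaryGroup.LocalRing L v)ˣ →* ℂˣ) (χ₂ : ↥(normOneUnits (conjLocal L (IsCMField.complexConj L) v)) →* ℂˣ)
    (h₁ : Continuous (fun x => ((χ₁ x : ℂˣ) : ℂ))) (h₂ : Continuous (fun x => ((χ₂ x : ℂˣ) : ℂ))) (hnu : ∃ x, ‖((χ₁ x : ℂˣ) : ℂ)‖ ≠ 1)
    (hcontr : ∀ x : (UnitaryGroup.LocalRing L v)ˣ, unitModulusChar (UnitaryGroup.LocalRing L v) x < 1 → ‖((χ₁ x : ℂˣ) : ℂ)‖ < 1)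
    (hred : ∃ N : Subrepresentation (UnitaryGroup.cmPrincipalSeries L 3 v (UnitaryGroup.cmTorusCharPair L v χ₁ χ₂)), N ≠ ⊥ ∧ N ≠ ⊤) :
    χ₁ = halfModulusChar (UnitaryGroup.LocalRing L v) * halfModulusChar (UnitaryGroup.LocalRing L v) ∨
      (∃ η : (UnitaryGroup.LocalRing L v)ˣ →* ℂˣ, IsQuadraticCharExtension (conjLocal L (IsCMField.complexConj L) v) η ∧
        Continuous (fun x => ((η x : ℂˣ) : ℂ)) ∧ χ₁ = η * halfModulusChar (UnitaryGroup.LocalRing L v)) := by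
  by_cases hunr : ∀ u ∈ (Submonoid.pi Set.univ (fun w : PlacesOver L v => (w.1.adicCompletionIntegers L).toSubring.toSubmonoid)).units, χ₁ u = 1
  · exact K2E3KeysThmTwoContractingUnramifiedChar.keysThmTwoContracting_of_unramifiedChar L v hns χ₁ χ₂ h₁ h₂ hnu hcontr hunr hred
  · exact H χ₁ h₁ hnu hcontr hunr ((K2E3PrincipalSeriesDetTwist.reducible_iff_reducible_one L v χ₁ χ₂ h₂).1 hred)

/-- **The same elimination over the TWO-coordinate leaf of census (D59) (E2)** («`χ₁` ramified, `χ₂` kept» — (U4f-χ₁-ram) `sig_K2E3KeysThmTwoContractingRamifiedChar`): U4-f at `(L, v)` for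
every pair follows from U4-f for the pairs with `χ₁` RAMIFIED (`by_cases`; unramified ↦ ★ p857431). [cite: Keys1984, §7 Theorem (2) p. 126] [cite: Rogawski1990, §12.2 (1)–(2) p. 173] -/
theorem keysThmTwoContracting_of_ramifiedChar
    (hns : ∀ w : PlacesOver L v, IsCMField.complexConj L • w.1 = w.1)
    (H : ∀ (χ₁ : (UnitaryGroup.LocalRing L v)ˣ →* ℂˣ) (χ₂ : ↥(normOneUnits (conjLocal L (IsCMField.complexConj L) v)) →* ℂˣ),
      Continuous (fun x => ((χ₁ x : ℂˣ) : ℂ)) → Continuous (fun x => ((χ₂ x : ℂˣ) : ℂ)) → (∃ x, ‖((χ₁ x : ℂˣ) : ℂ)‖ ≠ 1) →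
      (∀ x : (UnitaryGroup.LocalRing L v)ˣ, unitModulusChar (UnitaryGroup.LocalRing L v) x < 1 → ‖((χ₁ x : ℂˣ) : ℂ)‖ < 1) →
      ¬ (∀ u ∈ (Submonoid.pi Set.univ (fun w : PlacesOver L v => (w.1.adicCompletionIntegers L).toSubring.toSubmonoid)).units, χ₁ u = 1) →
      (∃ N : Subrepresentation (UnitaryGroup.cmPrincipalSeries L 3 v (UnitaryGroup.cmTorusCharPair L v χ₁ χ₂)), N ≠ ⊥ ∧ N ≠ ⊤) →
      χ₁ = halfModulusChar (UnitaryGroup.LocalRing L v) * halfModulusChar (UnitaryGroup.LocalRing L v) ∨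
        (∃ η : (UnitaryGroup.LocalRing L v)ˣ →* ℂˣ, IsQuadraticCharExtension (conjLocal L (IsCMField.complexConj L) v) η ∧
          Continuous (fun x => ((η x : ℂˣ) : ℂ)) ∧ χ₁ = η * halfModulusChar (UnitaryGroup.LocalRing L v)))
    (χ₁ : (UnitaryGroup.LocalRing L v)ˣ →* ℂˣ) (χ₂ : ↥(normOneUnits (conjLocal L (IsCMField.complexConj L) v)) →* ℂˣ)
    (h₁ : Continuous (fun x => ((χ₁ x : ℂˣ) : ℂ))) (h₂ : Continuous (fun x => ((χ₂ x : ℂˣ) : ℂ))) (hnu : ∃ x, ‖((χ₁ x : ℂˣ) : ℂ)‖ ≠ 1)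
    (hcontr : ∀ x : (UnitaryGroup.LocalRing L v)ˣ, unitModulusChar (UnitaryGroup.LocalRing L v) x < 1 → ‖((χ₁ x : ℂˣ) : ℂ)‖ < 1)
    (hred : ∃ N : Subrepresentation (UnitaryGroup.cmPrincipalSeries L 3 v (UnitaryGroup.cmTorusCharPair L v χ₁ χ₂)), N ≠ ⊥ ∧ N ≠ ⊤) :
    χ₁ = halfModulusChar (UnitaryGroup.LocalRing L v) * halfModulusChar (UnitaryGroup.LocalRing L v) ∨
      (∃ η : (UnitaryGroup.LocalRing L v)ˣ →* ℂˣ, IsQuadraticCharExtension (conjLocal L (IsCMField.complexConj L) v) η ∧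
        Continuous (fun x => ((η x : ℂˣ) : ℂ)) ∧ χ₁ = η * halfModulusChar (UnitaryGroup.LocalRing L v)) := by
  by_cases hunr : ∀ u ∈ (Submonoid.pi Set.univ (fun w : PlacesOver L v => (w.1.adicCompletionIntegers L).toSubring.toSubmonoid)).units, χ₁ u = 1
  · exact K2E3KeysThmTwoContractingUnramifiedChar.keysThmTwoContracting_of_unramifiedChar L v hns χ₁ χ₂ h₁ h₂ hnu hcontr hunr hred
  · exact H χ₁ χ₂ h₁ h₂ hnu hcontr hunr hred

/-- **The two-coordinate leaf follows from the `χ₂`-free one** (so hosting (U4f-χ₁-ram-one) loses nothing against (E2)'s (U4f-χ₁-ram)): for ramified `χ₁` and any continuous `χ₂`,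
reducibility of `i_G(χ₁, χ₂)` is that of `i_G(χ₁, 1)` (★ p857080). [cite: BernsteinZelevinsky1977, 1.9] [cite: Rogawski1990, §12.1 p. 171] -/
theorem ramifiedChar_of_ramifiedCharOne
    (H : ∀ χ₁ : (UnitaryGroup.LocalRing L v)ˣ →* ℂˣ, Continuous (fun x => ((χ₁ x : ℂˣ) : ℂ)) → (∃ x, ‖((χ₁ x : ℂˣ) : ℂ)‖ ≠ 1) →
      (∀ x : (UnitaryGroup.LocalRing L v)ˣ, unitModulusChar (UnitaryGroup.LocalRing L v) x < 1 → ‖((χ₁ x : ℂˣ) : ℂ)‖ < 1) →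
      ¬ (∀ u ∈ (Submonoid.pi Set.univ (fun w : PlacesOver L v => (w.1.adicCompletionIntegers L).toSubring.toSubmonoid)).units, χ₁ u = 1) →
      (∃ N : Subrepresentation (UnitaryGroup.cmPrincipalSeries L 3 v (UnitaryGroup.cmTorusCharPair L v χ₁ 1)), N ≠ ⊥ ∧ N ≠ ⊤) →
      χ₁ = halfModulusChar (UnitaryGroup.LocalRing L v) * halfModulusChar (UnitaryGroup.LocalRing L v) ∨
        (∃ η : (UnitaryGroup.LocalRing L v)ˣ →* ℂˣ, IsQuadraticCharExtension (conjLocal L (IsCMField.complexConj L) v) η ∧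
          Continuous (fun x => ((η x : ℂˣ) : ℂ)) ∧ χ₁ = η * halfModulusChar (UnitaryGroup.LocalRing L v)))
    (χ₁ : (UnitaryGroup.LocalRing L v)ˣ →* ℂˣ) (χ₂ : ↥(normOneUnits (conjLocal L (IsCMField.complexConj L) v)) →* ℂˣ)
    (h₁ : Continuous (fun x => ((χ₁ x : ℂˣ) : ℂ))) (h₂ : Continuous (fun x => ((χ₂ x : ℂˣ) : ℂ))) (hnu : ∃ x, ‖((χ₁ x : ℂˣ) : ℂ)‖ ≠ 1)
    (hcontr : ∀ x : (UnitaryGroup.LocalRing L v)ˣ, unitModulusChar (UnitaryGroup.LocalRing L v) x < 1 → ‖((χ₁ x : ℂˣ) : ℂ)‖ < 1)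
    (hram : ¬ (∀ u ∈ (Submonoid.pi Set.univ (fun w : PlacesOver L v => (w.1.adicCompletionIntegers L).toSubring.toSubmonoid)).units, χ₁ u = 1))
    (hred : ∃ N : Subrepresentation (UnitaryGroup.cmPrincipalSeries L 3 v (UnitaryGroup.cmTorusCharPair L v χ₁ χ₂)), N ≠ ⊥ ∧ N ≠ ⊤) :
    χ₁ = halfModulusChar (UnitaryGroup.LocalRing L v) * halfModulusChar (UnitaryGroup.LocalRing L v) ∨
      (∃ η : (UnitaryGroup.LocalRing L v)ˣ →* ℂˣ, IsQuadraticCharExtension (conjLocal L (IsCMField.complexConj L) v) η ∧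
        Continuous (fun x => ((η x : ℂˣ) : ℂ)) ∧ χ₁ = η * halfModulusChar (UnitaryGroup.LocalRing L v)) :=
  H χ₁ h₁ hnu hcontr hram ((K2E3PrincipalSeriesDetTwist.reducible_iff_reducible_one L v χ₁ χ₂ h₂).1 hred)

/-! ## §3 ED. 5's open leaf (U4f-ram-χ) `sig_K2E3KeysThmTwoContractingPosLevel` ⟸ the `χ₂`-free leaf (append-only re-tie of ED. 5) -/

/-- **(U4f-ram-χ) ⟸ (U4f-χ₁-ram-one).**  The binders of `U4Keys.sig_K2E3KeysThmTwoContractingPosLevel` (ED. 5 :124) VERBATIM at `(L, v)`, its `¬ hU` kept (idle), follow from the `χ₂`-free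
leaf `H` of §2 (`keysThmTwoContracting_of_ramifiedCharOne`).  Tie shape for the dealer: `sig_K2E3KeysThmTwoContractingPosLevel := fun L _ _ _ v hns χ₁ χ₂ h₁ h₂ hnu hcontr hU hred =>
keysThmTwoContractingPosLevel_of_ramifiedCharOne L v hns (sig_K2E3KeysThmTwoContractingRamifiedCharOne L v hns) χ₁ χ₂ h₁ h₂ hnu hcontr hU hred`.
[cite: Keys1984, §7 Theorem (2) p. 126] [cite: Rogawski1990, §12.2 (1)–(2) p. 173] -/
theorem keysThmTwoContractingPosLevel_of_ramifiedCharOne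
    (hns : ∀ w : PlacesOver L v, IsCMField.complexConj L • w.1 = w.1)
    (H : ∀ χ₁ : (UnitaryGroup.LocalRing L v)ˣ →* ℂˣ, Continuous (fun x => ((χ₁ x : ℂˣ) : ℂ)) → (∃ x, ‖((χ₁ x : ℂˣ) : ℂ)‖ ≠ 1) →
      (∀ x : (UnitaryGroup.LocalRing L v)ˣ, unitModulusChar (UnitaryGroup.LocalRing L v) x < 1 → ‖((χ₁ x : ℂˣ) : ℂ)‖ < 1) →
      ¬ (∀ u ∈ (Submonoid.pi Set.univ (fun w : PlacesOver L v => (w.1.adicCompletionIntegers L).toSubring.toSubmonoid)).units, χ₁ u = 1) →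
      (∃ N : Subrepresentation (UnitaryGroup.cmPrincipalSeries L 3 v (UnitaryGroup.cmTorusCharPair L v χ₁ 1)), N ≠ ⊥ ∧ N ≠ ⊤) →
      χ₁ = halfModulusChar (UnitaryGroup.LocalRing L v) * halfModulusChar (UnitaryGroup.LocalRing L v) ∨
        (∃ η : (UnitaryGroup.LocalRing L v)ˣ →* ℂˣ, IsQuadraticCharExtension (conjLocal L (IsCMField.complexConj L) v) η ∧
          Continuous (fun x => ((η x : ℂˣ) : ℂ)) ∧ χ₁ = η * halfModulusChar (UnitaryGroup.LocalRing L v)))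
    (χ₁ : (UnitaryGroup.LocalRing L v)ˣ →* ℂˣ) (χ₂ : ↥(normOneUnits (conjLocal L (IsCMField.complexConj L) v)) →* ℂˣ)
    (h₁ : Continuous (fun x => ((χ₁ x : ℂˣ) : ℂ))) (h₂ : Continuous (fun x => ((χ₂ x : ℂˣ) : ℂ))) (hnu : ∃ x, ‖((χ₁ x : ℂˣ) : ℂ)‖ ≠ 1)
    (hcontr : ∀ x : (UnitaryGroup.LocalRing L v)ˣ, unitModulusChar (UnitaryGroup.LocalRing L v) x < 1 → ‖((χ₁ x : ℂˣ) : ℂ)‖ < 1)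
    (_hU : ¬ (∀ t : ↥(torusU (conjLocal L (IsCMField.complexConj L) v) (cmLocalForm L 3 v)),
      (t : ↥(unitaryGroupOfForm (conjLocal L (IsCMField.complexConj L) v) (cmLocalForm L 3 v))) ∈ cmLocalIntegralLevel L 3 (qsForm L) v →
        UnitaryGroup.cmTorusCharPair L v χ₁ χ₂ t = 1))
    (hred : ∃ N : Subrepresentation (UnitaryGroup.cmPrincipalSeries L 3 v (UnitaryGroup.cmTorusCharPair L v χ₁ χ₂)), N ≠ ⊥ ∧ N ≠ ⊤) :
    χ₁ = halfModulusChar (UnitaryGroup.LocalRing L v) * halfModulusChar (UnitaryGroup.LocalRing L v) ∨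
      (∃ η : (UnitaryGroup.LocalRing L v)ˣ →* ℂˣ, IsQuadraticCharExtension (conjLocal L (IsCMField.complexConj L) v) η ∧
        Continuous (fun x => ((η x : ℂˣ) : ℂ)) ∧ χ₁ = η * halfModulusChar (UnitaryGroup.LocalRing L v)) :=
  keysThmTwoContracting_of_ramifiedCharOne L v hns H χ₁ χ₂ h₁ h₂ hnu hcontr hred

/-- **Under `¬ hU` AND `χ₁` unramified, necessarily `χ₂ ≠ 1`** — the slice of (U4f-ram-χ) that ★ p857431 pays (recorded for the census bookkeeping: (U4f-ram-χ) = «`χ₁` unramified, `χ₂ ≠ 1`» ⊔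
«`χ₁` ramified»). [cite: Rogawski1990, §12.1 p. 171; §12.2 p. 173] -/
theorem chiTwo_ne_one_of_not_levelTrivial_of_chiOneUnramified (hns : ∀ w : PlacesOver L v, IsCMField.complexConj L • w.1 = w.1)
    (χ₁ : (UnitaryGroup.LocalRing L v)ˣ →* ℂˣ) (χ₂ : ↥(normOneUnits (conjLocal L (IsCMField.complexConj L) v)) →* ℂˣ)
    (hU : ¬ (∀ t : ↥(torusU (conjLocal L (IsCMField.complexConj L) v) (cmLocalForm L 3 v)),
      (t : ↥(unitaryGroupOfForm (conjLocal L (IsCMField.complexConj L) v) (cmLocalForm L 3 v))) ∈ cmLocalIntegralLevel L 3 (qsForm L) v →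
        UnitaryGroup.cmTorusCharPair L v χ₁ χ₂ t = 1))
    (hunr : ∀ u ∈ (Submonoid.pi Set.univ (fun w : PlacesOver L v => (w.1.adicCompletionIntegers L).toSubring.toSubmonoid)).units, χ₁ u = 1) :
    χ₂ ≠ 1 := by
  rintro rfl
  exact hU (K2E3KeysThmTwoUnramifiedLineReduction.cmTorusCharPair_one_eq_one_of_unramified L v hns χ₁ hunr)

end Summit.HodgeConjecture.HodgeConjecture.Cruxes.H413.K2E3KeysThmTwoChiTwoElimination

end
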